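import Summits.AtomisticToContinuum.Crystallization.Theorems.ChargedEnergyGap.Negative.PeriodicFormConverse
import Summits.AtomisticToContinuum.Crystallization.Theorems.ChargedEnergyGap.Negative.Unconditional

/-!
# `ChargedEnergyGap` (stmt-AtomisticToContinuum-14231), negative side VIII: the admissible-price constant and what the crux forces on periodic configurations

Two groups of consequences of parts I–VII (refuter lineage, `cdisprove` gen 3; nothing here
asserts a route item positively).

**A. One variational constant.**  `kappaMax η = ⨅ (E_LJ(y) − N·e*)/#charged_η(y)` over the
finite injective configurations of `ℝ³` with at least one charged site (non-empty: the dimer;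
bounded below by `0`: `excess_nonneg`).  Then `NoBoundary η κ ↔ κ ≤ kappaMax η`
(`noBoundary_iff_le_kappaMax`) and `GapWith η (kappaMax η) 0` holds UNCONDITIONALLY
(`gapWith_kappaMax`), so **`ChargedEnergyGap ↔ 0 < kappaMax (1/100)`**
(`chargedEnergyGap_iff_kappaMax_pos`): the crux is the strict positivity of one number, and
every explicit charged configuration is a certified upper bound for it (`kappaMax_le_ratio`;
the dimer gives `kappaMax η ≤ −1/24 − e*`, `kappaMax_le_dimer`).  Numerically (work file
`Cruxes/ChargedEnergyGap/Disproof.lean` §7) `kappaMax (1/100) ≲ 3.4·10⁻⁵`.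

**B. What a proof must deliver on the periodic side** (via part VII,
`ChargedEnergyGap ↔ ∃ κ > 0, PeriodicPricing (1/100) κ`):
* `chargedFraction_le_of_periodicPricing` — the charged fraction of the motif of EVERY periodic
  configuration is at most `(e(Q) − e*)/κ`;
* `forall_isChargeFree_of_periodicPricing` — a periodic configuration with `e(Q) = e*` (a periodic
  Lennard-Jones ground state) is charge-free AT EVERY POINT; in the summit's vocabulary,
  `isChargeFree_of_isLeast`: under the crux the minimiser `P` of `HasPeriodicGroundStateEnergy`
  (conjunct (i) of `Crystallization`) has cuboctahedral / anticuboctahedral soft links everywhere;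
* `le_energyPerParticle_of_forall_charged` — every periodic configuration ALL of whose points are
  charged (bcc, sc, A15, …, but also hcp/fcc strained homogeneously past the 1 % threshold) has
  `e(Q) ≥ e* + κ`: a uniform energy gap above the ground-state energy for the whole fully-charged
  class;
* `tendsto_chargedFraction_of_chargedEnergyGap` — along every minimising sequence of periodic
  configurations the charged fraction tends to `0` (the periodic twin of the route target
  `ZeroChargeBulk`).
The corresponding KILL CRITERIA, usable by later seats without any finite-`N` boundary
bookkeeping: `not_gapWith_of_charged_minimiser` / `not_chargedEnergyGap_of_charged_minimiser`
(one periodic ground state with one charged point), `not_chargedEnergyGap_of_cheap_periodic_charge`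
(periodic configurations paying `< κ` per charged motif site, for every `κ > 0`) and
`not_chargedEnergyGap_of_forall_charged_near` (fully charged periodic configurations with
energies per particle approaching `e*`).  All `[folklore]`.
-/

noncomputable section

namespace Summit.AtomisticToContinuum.Crystallization.Theorems.ChargedEnergyGapNegative

open Literature.MathematicalPhysics.StatisticalMechanics
open Literature.Geometry.DiscreteGeometry
open Summit.AtomisticToContinuum.Crystallization.Theses.PricedLinkCensus
open scoped BigOperators Topology
open Filter

/-! ## A. The admissible-price constant `kappaMax` -/

section KappaMax

/-- Index of the finite injective configurations of `ℝ³` with at least one charged site at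
tolerance `η`. [folklore] -/
def ChargedConfig (η : ℝ) : Type :=
  Σ N : ℕ, {y : Fin N → E3 // Function.Injective y ∧ 0 < charged η y}

/-- The price paid per charged site by a configuration: `(E_LJ(y) − N·e*)/#charged`. [folklore] -/
def ratio (η : ℝ) (s : ChargedConfig η) : ℝ :=
  (interactionEnergy lennardJones s.2.1 - (s.1 : ℝ) * eStar) / (charged η s.2.1 : ℝ)

/-- **The admissible-price constant** `κ_max(η) = ⨅_y (E_LJ(y) − N·e*)/#charged_η(y)` over
charged finite injective configurations. [folklore] -/
def kappaMax (η : ℝ) : ℝ := ⨅ s : ChargedConfig η, ratio η s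

/-- The dimer is a charged configuration at every tolerance (two sites, both charged). [folklore] -/
def dimerCharged (η : ℝ) : ChargedConfig η :=
  ⟨2, dimer, dimer_injective, by rw [charged_eq_of_le (by norm_num) dimer]; norm_num⟩

/-- The charged configurations form a non-empty type (the dimer). [folklore] -/
instance instNonemptyChargedConfig (η : ℝ) : Nonempty (ChargedConfig η) := ⟨dimerCharged η⟩

/-- Every ratio is non-negative (`N·e* ≤ E_LJ(y)` unconditionally). [folklore] -/
theorem ratio_nonneg (η : ℝ) (s : ChargedConfig η) : 0 ≤ ratio η s :=
  div_nonneg (excess_nonneg s.2.2.1) (Nat.cast_nonneg _)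

/-- The ratios are bounded below (by `0`). [folklore] -/
theorem bddBelow_ratio (η : ℝ) : BddBelow (Set.range (ratio η)) :=
  ⟨0, by rintro _ ⟨s, rfl⟩; exact ratio_nonneg η s⟩

/-- `0 ≤ κ_max`. [folklore] -/
theorem kappaMax_nonneg (η : ℝ) : 0 ≤ kappaMax η :=
  le_ciInf fun s => ratio_nonneg η s

/-- **Every charged configuration bounds the admissible price**:
`κ_max ≤ (E_LJ(y) − N·e*)/#charged(y)`. [folklore] -/
theorem kappaMax_le_ratio {η : ℝ} {N : ℕ} {y : Fin N → E3} (hy : Function.Injective y)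
    (hc : 0 < charged η y) :
    kappaMax η ≤ (interactionEnergy lennardJones y - (N : ℝ) * eStar) / (charged η y : ℝ) :=
  ciInf_le (bddBelow_ratio η) (⟨N, y, hy, hc⟩ : ChargedConfig η)

/-- The dimer bound: `κ_max(η) ≤ (−1/12 − 2e*)/2 = −1/24 − e*`. [folklore] -/
theorem kappaMax_le_dimer (η : ℝ) : kappaMax η ≤ -1 / 24 - eStar := by
  have h := kappaMax_le_ratio (η := η) dimer_injective
    (by rw [charged_eq_of_le (by norm_num) dimer]; norm_num)
  rw [charged_eq_of_le (by norm_num) dimer, interactionEnergy_dimer] at h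
  push_cast at h
  linarith

/-- **`NoBoundary η κ ↔ κ ≤ κ_max(η)`**: the admissible prices form exactly the ray
`(−∞, κ_max]`. [folklore] -/
theorem noBoundary_iff_le_kappaMax (η κ : ℝ) : NoBoundary η κ ↔ κ ≤ kappaMax η := by
  constructor
  · intro h
    refine le_ciInf fun s => ?_
    obtain ⟨N, y, hy, hc⟩ := s
    have hcR : (0 : ℝ) < charged η y := by exact_mod_cast hc
    rw [ratio, le_div_iff₀ hcR]
    linarith [h N y hy]
  · intro h N y hy
    rcases Nat.eq_zero_or_pos (charged η y) with hc | hc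
    · rw [hc, Nat.cast_zero, mul_zero, add_zero]
      exact card_mul_eStar_le hy
    · have hcR : (0 : ℝ) < charged η y := by exact_mod_cast hc
      have hle := (h.trans (kappaMax_le_ratio hy hc))
      rw [le_div_iff₀ hcR] at hle
      linarith

/-- `GapWith η κ C → κ ≤ κ_max(η)` (`η ≤ 1`). [folklore] -/
theorem le_kappaMax_of_gapWith {η κ C : ℝ} (hη1 : η ≤ 1) (h : GapWith η κ C) : κ ≤ kappaMax η :=
  (noBoundary_iff_le_kappaMax η κ).1 (noBoundary_of_gapWith hη1 h)

/-- **`ChargedEnergyGap ↔ 0 < κ_max(1/100)`**: the crux is the strict positivity of one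
variational constant. [folklore] -/
theorem chargedEnergyGap_iff_kappaMax_pos : ChargedEnergyGap ↔ 0 < kappaMax (1 / 100) := by
  rw [chargedEnergyGap_iff_noBoundary]
  constructor
  · rintro ⟨κ, hκ, h⟩
    exact hκ.trans_le ((noBoundary_iff_le_kappaMax _ _).1 h)
  · intro h
    exact ⟨kappaMax (1 / 100), h, (noBoundary_iff_le_kappaMax _ _).2 le_rfl⟩

/-- `κ_max(η)` itself is an admissible price (the largest one), unconditionally and with
allowance `C = 0`; the whole content of the crux is `κ_max(1/100) > 0`. [folklore] -/
theorem noBoundary_kappaMax (η : ℝ) : NoBoundary η (kappaMax η) :=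
  (noBoundary_iff_le_kappaMax _ _).2 le_rfl

/-- `GapWith η (κ_max η) 0`, unconditionally. [folklore] -/
theorem gapWith_kappaMax (η : ℝ) : GapWith η (kappaMax η) 0 :=
  gapWith_of_noBoundary (noBoundary_kappaMax η)

/-- `κ_max` is the LARGEST admissible price: `GapWith η κ C → κ ≤ κ_max η` and
`GapWith η (κ_max η) 0`; so `ChargedEnergyGap` holds with `κ = κ_max (1/100)`, `C = 0` if it
holds at all. [folklore] -/
theorem chargedEnergyGap_iff_gapWith_kappaMax :
    ChargedEnergyGap ↔ 0 < kappaMax (1 / 100) ∧ GapWith (1 / 100) (kappaMax (1 / 100)) 0 :=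
  ⟨fun h => ⟨chargedEnergyGap_iff_kappaMax_pos.1 h, gapWith_kappaMax _⟩,
    fun h => chargedEnergyGap_iff_kappaMax_pos.2 h.1⟩

end KappaMax

/-! ## B. Consequences for periodic configurations -/

section Periodic

open Blocks

variable {η κ : ℝ}

/-- The charged fraction of the motif of a periodic configuration. [folklore] -/
def chargedFraction (η : ℝ) (Q : PeriodicConfiguration 3) : ℝ :=
  (motifCharged η Q : ℝ) / (Q.motif.card : ℝ)

/-- `#charged motif sites ≤ #motif`. [folklore] -/
theorem motifCharged_le_card (η : ℝ) (Q : PeriodicConfiguration 3) :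
    motifCharged η Q ≤ Q.motif.card := by
  unfold motifCharged
  calc Nat.card {x : Q.motif // ¬ IsChargeFree η (Subtype.val : Q.points → E3)
          ⟨x.1, Q.mem_points_of_mem_motif x.2⟩}
      ≤ Nat.card Q.motif := Finite.card_subtype_le _
    _ = Q.motif.card := by rw [Nat.card_eq_fintype_card, Fintype.card_coe]

/-- `0 ≤ chargedFraction ≤ 1`. [folklore] -/
theorem chargedFraction_nonneg (η : ℝ) (Q : PeriodicConfiguration 3) : 0 ≤ chargedFraction η Q :=
  div_nonneg (Nat.cast_nonneg _) (Nat.cast_nonneg _)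

/-- `chargedFraction ≤ 1`. [folklore] -/
theorem chargedFraction_le_one (η : ℝ) (Q : PeriodicConfiguration 3) : chargedFraction η Q ≤ 1 := by
  have hF : (0 : ℝ) < Q.motif.card := by exact_mod_cast Q.motif_nonempty.card_pos
  rw [chargedFraction, div_le_one hF]
  exact_mod_cast motifCharged_le_card η Q

/-- All motif sites charged ⇒ `motifCharged = #motif`. [folklore] -/
theorem motifCharged_eq_card_of_forall
    {Q : PeriodicConfiguration 3} (h : ∀ p : Q.points, ¬ IsChargeFree η (ptConfig Q) p) :
    motifCharged η Q = Q.motif.card := by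
  unfold motifCharged
  have h' : ∀ x : Q.motif, ¬ IsChargeFree η (Subtype.val : Q.points → E3)
      ⟨x.1, Q.mem_points_of_mem_motif x.2⟩ := fun x => h _
  rw [Nat.card_congr (Equiv.subtypeUnivEquiv h'), Nat.card_eq_fintype_card, Fintype.card_coe]

/-- Every point of a periodic configuration is a period-translate of a motif point, so charge
read at the motif decides charge everywhere. [folklore] -/
theorem isChargeFree_pt_of_motif {Q : PeriodicConfiguration 3}
    (h : ∀ x (hx : x ∈ Q.motif), IsChargeFree η (ptConfig Q) ⟨x, Q.mem_points_of_mem_motif hx⟩)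
    (p : Q.points) : IsChargeFree η (ptConfig Q) p := by
  obtain ⟨x, hx, g, hg, hp⟩ := p.2
  have hpt : p = transl Q hg ⟨x, Q.mem_points_of_mem_motif hx⟩ :=
    Subtype.ext (by simp [transl, hp])
  rw [hpt, isChargeFree_transl]
  exact h x hx

/-- `motifCharged = 0` iff every point of the configuration is charge-free. [folklore] -/
theorem motifCharged_eq_zero_iff {Q : PeriodicConfiguration 3} :
    motifCharged η Q = 0 ↔ ∀ p : Q.points, IsChargeFree η (ptConfig Q) p := by
  constructor
  · intro h0 p
    refine isChargeFree_pt_of_motif (fun x hx => ?_) p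
    by_contra hx'
    have : 0 < motifCharged η Q := by
      unfold motifCharged
      exact Nat.card_pos_iff.2 ⟨⟨⟨⟨x, hx⟩, hx'⟩⟩, inferInstance⟩
    omega
  · intro h
    unfold motifCharged
    haveI : IsEmpty {x : Q.motif // ¬ IsChargeFree η (Subtype.val : Q.points → E3)
        ⟨x.1, Q.mem_points_of_mem_motif x.2⟩} := ⟨fun x => x.2 (h _)⟩
    exact Nat.card_of_isEmpty

/-- **Charged fraction ≤ excess / price** for every periodic configuration. [folklore] -/
theorem chargedFraction_le_of_periodicPricing (hκ : 0 < κ) (h : PeriodicPricing η κ)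
    (Q : PeriodicConfiguration 3) :
    chargedFraction η Q ≤ (Q.energyPerParticle lennardJones - eStar) / κ := by
  have hF : (0 : ℝ) < Q.motif.card := by exact_mod_cast Q.motif_nonempty.card_pos
  rw [chargedFraction, div_le_div_iff₀ hF hκ]
  have := h Q
  nlinarith [this]

/-- **Periodic ground states carry no charge** (given the pricing): `e(Q) = e*` forces
`motifCharged η Q = 0`. [folklore] -/
theorem motifCharged_eq_zero_of_periodicPricing (hκ : 0 < κ) (h : PeriodicPricing η κ)
    {Q : PeriodicConfiguration 3} (hQ : Q.energyPerParticle lennardJones = eStar) :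
    motifCharged η Q = 0 := by
  have := h Q
  rw [hQ, sub_self, mul_zero] at this
  have h0 : (motifCharged η Q : ℝ) ≤ 0 := by
    by_contra hpos
    push Not at hpos
    have := mul_pos hκ hpos
    linarith
  exact_mod_cast le_antisymm h0 (Nat.cast_nonneg _)

/-- … hence every point of a periodic ground state is charge-free. [folklore] -/
theorem forall_isChargeFree_of_periodicPricing (hκ : 0 < κ) (h : PeriodicPricing η κ)
    {Q : PeriodicConfiguration 3} (hQ : Q.energyPerParticle lennardJones = eStar)
    (p : Q.points) : IsChargeFree η (ptConfig Q) p :=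
  motifCharged_eq_zero_iff.1 (motifCharged_eq_zero_of_periodicPricing hκ h hQ) p

/-- **Fully charged periodic configurations are uniformly gapped**: if every point of `Q` is
charged then `e* + κ ≤ e(Q)`. [folklore] -/
theorem le_energyPerParticle_of_forall_charged (h : PeriodicPricing η κ)
    {Q : PeriodicConfiguration 3} (hQ : ∀ p : Q.points, ¬ IsChargeFree η (ptConfig Q) p) :
    eStar + κ ≤ Q.energyPerParticle lennardJones := by
  have hF : (0 : ℝ) < Q.motif.card := by exact_mod_cast Q.motif_nonempty.card_pos
  have := h Q
  rw [motifCharged_eq_card_of_forall hQ] at this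
  nlinarith [this]

/-- `GapWith η κ C → PeriodicPricing η κ` for `0 ≤ η ≤ 1`, `0 ≤ κ` (parts II and VII). [folklore] -/
theorem periodicPricing_of_gapWith {C : ℝ} (hη0 : 0 ≤ η) (hη1 : η ≤ 1) (hκ : 0 ≤ κ)
    (h : GapWith η κ C) : PeriodicPricing η κ :=
  periodicPricing_of_noBoundary hη0 hη1 hκ (noBoundary_of_gapWith hη1 h)

/-- **Kill criterion 1 (per tolerance).** A periodic ground state (`e(Q) = e*`) with ONE
charged point at tolerance `η ∈ [0, 1]` refutes the priced gap at `η` for every `κ > 0` and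
every allowance `C`.  (At `η` below the bond-length split of the relaxed hcp shell, `≈ 10⁻⁴`
numerically, the optimal stacking itself is such a `Q` — granted it is optimal.) [folklore] -/
theorem not_gapWith_of_charged_minimiser (hη0 : 0 ≤ η) (hη1 : η ≤ 1)
    {Q : PeriodicConfiguration 3} (hQ : Q.energyPerParticle lennardJones = eStar)
    (hp : ∃ p : Q.points, ¬ IsChargeFree η (ptConfig Q) p) (hκ : 0 < κ) (C : ℝ) :
    ¬ GapWith η κ C := by
  intro h
  obtain ⟨p, hp⟩ := hp
  exact hp (forall_isChargeFree_of_periodicPricing hκ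
    (periodicPricing_of_gapWith hη0 hη1 hκ.le h) hQ p)

/-- **Kill criterion 1 (crux).** A periodic Lennard-Jones ground state with one point that is
not charge-free at tolerance `1/100` refutes `ChargedEnergyGap`. [folklore] -/
theorem not_chargedEnergyGap_of_charged_minimiser
    {Q : PeriodicConfiguration 3} (hQ : Q.energyPerParticle lennardJones = eStar)
    (hp : ∃ p : Q.points, ¬ IsChargeFree (1 / 100) (ptConfig Q) p) : ¬ ChargedEnergyGap := by
  rw [chargedEnergyGap_iff]
  rintro ⟨κ, C, hκ, h⟩
  exact not_gapWith_of_charged_minimiser (by norm_num) (by norm_num) hQ hp hκ C h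

/-- **Kill criterion 2 (crux).** Periodic configurations paying less than `κ` per charged motif
site, for every `κ > 0`, refute `ChargedEnergyGap`. [folklore] -/
theorem not_chargedEnergyGap_of_cheap_periodic_charge
    (h : ∀ κ : ℝ, 0 < κ → ∃ Q : PeriodicConfiguration 3,
      (Q.motif.card : ℝ) * (Q.energyPerParticle lennardJones - eStar) <
        κ * (motifCharged (1 / 100) Q : ℝ)) :
    ¬ ChargedEnergyGap := by
  rw [chargedEnergyGap_iff_periodicPricing]
  rintro ⟨κ, hκ, hP⟩
  obtain ⟨Q, hQ⟩ := h κ hκ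
  exact absurd (hP Q) (not_le.2 hQ)

/-- **Kill criterion 3 (crux).** Fully charged periodic configurations with energy per particle
arbitrarily close to `e*` refute `ChargedEnergyGap`. [folklore] -/
theorem not_chargedEnergyGap_of_forall_charged_near
    (h : ∀ ε : ℝ, 0 < ε → ∃ Q : PeriodicConfiguration 3,
      (∀ p : Q.points, ¬ IsChargeFree (1 / 100) (ptConfig Q) p) ∧
        Q.energyPerParticle lennardJones < eStar + ε) :
    ¬ ChargedEnergyGap := by
  rw [chargedEnergyGap_iff_periodicPricing]
  rintro ⟨κ, hκ, hP⟩
  obtain ⟨Q, hQ, hlt⟩ := h κ hκ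
  linarith [le_energyPerParticle_of_forall_charged hP hQ]

/-- **Under the crux, minimising sequences of periodic configurations have charged fraction
tending to `0`** (the periodic twin of the route target `ZeroChargeBulk`). [folklore] -/
theorem tendsto_chargedFraction_of_chargedEnergyGap (h : ChargedEnergyGap)
    {Q : ℕ → PeriodicConfiguration 3}
    (hQ : Tendsto (fun n => (Q n).energyPerParticle lennardJones) atTop (𝓝 eStar)) :
    Tendsto (fun n => chargedFraction (1 / 100) (Q n)) atTop (𝓝 0) := by
  obtain ⟨κ, hκ, hP⟩ := chargedEnergyGap_iff_periodicPricing.1 h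
  have hup : Tendsto (fun n => ((Q n).energyPerParticle lennardJones - eStar) / κ) atTop
      (𝓝 ((eStar - eStar) / κ)) := (hQ.sub_const eStar).div_const κ
  rw [sub_self, zero_div] at hup
  exact tendsto_of_tendsto_of_tendsto_of_le_of_le tendsto_const_nhds hup
    (fun n => chargedFraction_nonneg _ _) (fun n => chargedFraction_le_of_periodicPricing hκ hP _)

/-- **Under the crux, every charged fraction is controlled by the excess**:
`∃ κ > 0, ∀ Q, chargedFraction (1/100) Q ≤ (e(Q) − e*)/κ`. [folklore] -/
theorem chargedFraction_le_of_chargedEnergyGap (h : ChargedEnergyGap) :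
    ∃ κ : ℝ, 0 < κ ∧ ∀ Q : PeriodicConfiguration 3,
      chargedFraction (1 / 100) Q ≤ (Q.energyPerParticle lennardJones - eStar) / κ := by
  obtain ⟨κ, hκ, hP⟩ := chargedEnergyGap_iff_periodicPricing.1 h
  exact ⟨κ, hκ, chargedFraction_le_of_periodicPricing hκ hP⟩

/-- A least element of the periodic energies per particle has energy `e*`. [folklore] -/
theorem energyPerParticle_eq_eStar_of_isLeast {P : PeriodicConfiguration 3}
    (hP : IsLeast (Set.range fun Q : PeriodicConfiguration 3 => Q.energyPerParticle lennardJones)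
      (P.energyPerParticle lennardJones)) :
    P.energyPerParticle lennardJones = eStar :=
  le_antisymm (hP.2 ⟨P, rfl⟩ |> fun _ => le_ciInf fun Q => hP.2 ⟨Q, rfl⟩) (eStar_le P)

/-- **Under the crux, the periodic ground state of the `Crystallization` conjunct
`HasPeriodicGroundStateEnergy lennardJones 3` is charge-free at every point** (its soft links
at tolerance `1/100` are all `4`-regular on twelve vertices). [folklore] -/
theorem isChargeFree_of_isLeast (h : ChargedEnergyGap) {P : PeriodicConfiguration 3}
    (hP : IsLeast (Set.range fun Q : PeriodicConfiguration 3 => Q.energyPerParticle lennardJones)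
      (P.energyPerParticle lennardJones)) (p : P.points) :
    IsChargeFree (1 / 100) (ptConfig P) p := by
  obtain ⟨κ, hκ, hPP⟩ := chargedEnergyGap_iff_periodicPricing.1 h
  exact forall_isChargeFree_of_periodicPricing hκ hPP (energyPerParticle_eq_eStar_of_isLeast hP) p

/-- The same, packaged against the summit's conjunct (i): if `ChargedEnergyGap` holds and
Lennard-Jones has a periodic ground-state energy in `ℝ³`, then some periodic minimiser exists
all of whose points are charge-free at tolerance `1/100`. [folklore] -/
theorem exists_chargeFree_minimiser_of_chargedEnergyGap (h : ChargedEnergyGap)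
    (hG : HasPeriodicGroundStateEnergy lennardJones 3) :
    ∃ P : PeriodicConfiguration 3,
      IsLeast (Set.range fun Q : PeriodicConfiguration 3 => Q.energyPerParticle lennardJones)
        (P.energyPerParticle lennardJones) ∧
      ∀ p : P.points, IsChargeFree (1 / 100) (ptConfig P) p := by
  obtain ⟨P, hP, -⟩ := hG
  exact ⟨P, hP, isChargeFree_of_isLeast h hP⟩

end Periodic

end Summit.AtomisticToContinuum.Crystallization.Theorems.ChargedEnergyGapNegative

end
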